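import Literature.Analysis.FunctionSpaces.LatticeConvolution
import Literature.Analysis.FunctionSpaces.LatticeSobolevDeriv
import HarnessLib

/-!
# Convolution operators on the lattice Sobolev scale, II: Leibniz rules, translations,
# composition (Warner 6.19, 6.24–6.26)

Continuation of `LatticeConvolution.lean` (`Lattice.conv a c`, the action on Fourier coefficients
of multiplication by a smooth matrix-valued function with coefficient family `a`). Here are the
algebraic identities that make the symbolic calculus of periodic differential operators
(F. W. Warner, GTM 94 (1983), 6.24–6.26, 6.30 (2)) work on the lattice:

* `Lattice.freqDeriv_conv` — **Leibniz rule** `∂_j (a ⋆ c) = (∂_j a) ⋆ c + a ⋆ (∂_j c)`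
  (`k_j = (k - l)_j + l_j`), i.e. the commutator `[∂_j, a ⋆] = (∂_j a) ⋆` is a multiplication
  operator again — the order-zero commutator behind Warner's Remark 6.26;
* translations `Lattice.transl j t c = (e^{2πi k_j t}) • c` (Warner 6.19 (1)): isometric on every
  `H_s`, multiplicative over convolutions `T(a ⋆ c) = (T a) ⋆ (T c)`, and the difference-quotient
  Leibniz rule `(a ⋆ c)^t = a^t ⋆ (T c) + a ⋆ c^t` — Warner's 6.30 (2),
  "`L(u^h) = (Lu)^h - L^h(T_h u)`";
* the Kronecker symbol `Lattice.delta T` of a constant coefficient `T` (`delta T ⋆ c = T ∘ c`);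
* composition: the symbol `Lattice.sconv a b = ∑_l a(k-l) ∘ b(l)` of the product of two multipliers
  is rapidly decreasing with `a, b` (`RapidDecay.sconv`) and `a ⋆ (b ⋆ c) = (a ⋆ b) ⋆ c` for
  tempered `c` (`Lattice.conv_conv`, Fubini for the absolutely convergent double series).

All identities hold for rapidly decreasing symbols and tempered (`H_{-∞}`) families, the generality
in which Warner uses them ("for `φ ∈ 𝒫`, and hence by continuity for all `u ∈ H_{-∞}`", 6.30).

## References

* F. W. Warner, *Foundations of Differentiable Manifolds and Lie Groups*, GTM 94 (1983), 6.19 (1),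
  (3), 6.24, Remark 6.26, 6.30 (2). [WarnerGTM94]
-/

open Filter
open scoped ENNReal NNReal Topology

noncomputable section

namespace Literature.Analysis.FunctionSpaces

namespace Lattice

open Torus

variable {d : Type*}
variable {V W X : Type*} [NormedAddCommGroup V] [NormedSpace ℂ V] [NormedAddCommGroup W]
  [NormedSpace ℂ W] [NormedAddCommGroup X] [NormedSpace ℂ X]

/-! ### Summable majorants -/

section Majorant

variable [Fintype d]

/-- The basic summable majorant: for a rapidly decreasing symbol `a` and any real order `r`,
`l ↦ ‖a(k-l)‖ ⟨l⟩^r` is summable (`⟨l⟩^r ≤ 2^{|r|/2}⟨l-k⟩^{|r|}⟨k⟩^r`, Peetre). [folklore] -/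
theorem summable_norm_symbol_mul_weight {a : (d → ℤ) → (V →L[ℂ] W)} (ha : RapidDecay a) (r : ℝ)
    (k : d → ℤ) : Summable fun l => ‖a (k - l)‖ * sobolevWeight r l := by
  have h1 : Summable fun l => sobolevWeight |r| l * ‖a l‖ := by
    have := ENNReal.summable_toReal (symbNorm_lt_top_of_rapidDecay ha |r|).ne
    refine this.congr fun l => ?_
    rw [ENNReal.toReal_mul, ENNReal.toReal_ofReal (sobolevWeight_pos _ _).le, toReal_enorm]
  have hmaj : Summable fun l => sobolevWeight |r| (k - l) * ‖a (k - l)‖ :=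
    (Equiv.subLeft k).summable_iff.2 h1 |>.congr fun l => by simp [Equiv.subLeft]
  refine Summable.of_nonneg_of_le (fun l => by positivity [sobolevWeight_pos r l]) (fun l => ?_)
    (hmaj.mul_left ((2 : ℝ) ^ (|r| / 2) * sobolevWeight r k))
  have hp : sobolevWeight r l ≤ (2 : ℝ) ^ (|r| / 2) * sobolevWeight |r| (k - l) * sobolevWeight r k := by
    have h := sobolevWeight_le_peetre r l k
    rwa [show sobolevWeight |r| (l - k) = sobolevWeight |r| (k - l) by
      rw [sobolevWeight, sobolevWeight, freqNormSq_sub_comm]] at h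
  calc ‖a (k - l)‖ * sobolevWeight r l
      ≤ ‖a (k - l)‖ * ((2 : ℝ) ^ (|r| / 2) * sobolevWeight |r| (k - l) * sobolevWeight r k) := by gcongr
    _ = (2 : ℝ) ^ (|r| / 2) * sobolevWeight r k * (sobolevWeight |r| (k - l) * ‖a (k - l)‖) := by ring

omit [NormedSpace ℂ V] in
/-- Quantitative form of temperedness used in double sums: a tempered family is dominated by a
weight, `‖c l‖ ≤ N ⟨l⟩^{r}` for some `r` and finite `N ≥ 0`. [folklore] -/
theorem Tempered.exists_norm_le_weight {c : (d → ℤ) → V} (hc : Tempered c) :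
    ∃ r N : ℝ, 0 ≤ N ∧ ∀ l, ‖c l‖ ≤ N * sobolevWeight r l := by
  obtain ⟨s, hs⟩ := hc
  exact ⟨-s, (eNorm s c).toReal, ENNReal.toReal_nonneg, fun l => by
    rw [mul_comm]; exact norm_apply_le_of_eNormSq_lt_top hs l⟩

omit [NormedSpace ℂ V] in
/-- A family dominated by a weight is tempered: it lies in `H_{-r-#d}` (compare with the constant
family, `∑_l ⟨l⟩^{-2#d} < ∞`): the converse of `Tempered.exists_norm_le_weight`. [folklore] -/
theorem tempered_of_norm_le_weight {c : (d → ℤ) → V} {r N : ℝ}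
    (h : ∀ l, ‖c l‖ ≤ N * sobolevWeight r l) : Tempered c := by
  have hN : 0 ≤ N := by
    have h0 := (norm_nonneg _).trans (h 0)
    rwa [sobolevWeight_apply_zero, mul_one] at h0
  -- domination by the constant family `1 : ℤ^d → ℂ`, shifted by `r`
  have hdom := eNormSq_le_of_norm_le hN (s := -(r + Fintype.card d)) (t := r)
    (c := fun _ : d → ℤ => (1 : ℂ)) (c' := c) (fun l => by rw [norm_one, mul_one]; exact h l)
  refine ⟨-(r + Fintype.card d), hdom.trans_lt (ENNReal.mul_lt_top ENNReal.ofReal_lt_top ?_)⟩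
  have hs : -(r + (Fintype.card d : ℝ)) + r = -(Fintype.card d : ℝ) := by ring
  rw [hs]
  have hsum : Summable fun l : d → ℤ => sobolevWeight (-(Fintype.card d : ℝ)) l ^ 2 * ‖(1 : ℂ)‖ ^ 2 := by
    refine (summable_inv_one_add_freqNormSq_pow_card (d := d)).congr fun l => ?_
    rw [norm_one, one_pow, mul_one, sobolevWeight_neg, inv_pow, sobolevWeight_natCast_sq]
  exact eNormSq_lt_top_of_summable hsum

/-- **Absolute convergence of the double convolution sum** `∑_l ∑_m ‖a(k-l)‖ ‖b(l-m)‖ ‖c m‖`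
for rapidly decreasing `a, b` and tempered `c` (as a summable family on `ℤ^d × ℤ^d`).
[folklore] -/
theorem summable_norm_conv_conv_term {a : (d → ℤ) → (W →L[ℂ] X)} (ha : RapidDecay a)
    {b : (d → ℤ) → (V →L[ℂ] W)} (hb : RapidDecay b) {c : (d → ℤ) → V} (hc : Tempered c)
    (k : d → ℤ) :
    Summable fun p : (d → ℤ) × (d → ℤ) => ‖a (k - p.1)‖ * (‖b (p.1 - p.2)‖ * ‖c p.2‖) := by
  obtain ⟨r, N, hN, hcN⟩ := hc.exists_norm_le_weight
  -- inner sums: `∑_m ‖b(l-m)‖ ‖c m‖ ≤ N 2^{|r|/2} A_{|r|}... ⟨l⟩^r`, an explicit weight bound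
  have hinner : ∀ l, Summable fun m => ‖b (l - m)‖ * ‖c m‖ := fun l =>
    Summable.of_nonneg_of_le (fun m => by positivity) (fun m => by
      calc ‖b (l - m)‖ * ‖c m‖ ≤ ‖b (l - m)‖ * (N * sobolevWeight r m) := by gcongr; exact hcN m
        _ = N * (‖b (l - m)‖ * sobolevWeight r m) := by ring)
      ((summable_norm_symbol_mul_weight hb r l).mul_left N)
  -- the bound on the inner sums
  set B : ℝ := (symbNorm |r| b).toReal with hBdef
  have hBsum : ∀ l, ∑' m, ‖b (l - m)‖ * sobolevWeight r m ≤
      (2 : ℝ) ^ (|r| / 2) * sobolevWeight r l * B := fun l => by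
    have h1 : Summable fun m => sobolevWeight |r| m * ‖b m‖ := by
      have := ENNReal.summable_toReal (symbNorm_lt_top_of_rapidDecay hb |r|).ne
      refine this.congr fun m => ?_
      rw [ENNReal.toReal_mul, ENNReal.toReal_ofReal (sobolevWeight_pos _ _).le, toReal_enorm]
    have hB : ∑' m, sobolevWeight |r| (l - m) * ‖b (l - m)‖ = B := by
      have e := (Equiv.subLeft l).tsum_eq (fun m => sobolevWeight |r| m * ‖b m‖)
      simp only [Equiv.subLeft_apply] at e
      rw [e, hBdef, symbNorm,
        ENNReal.tsum_toReal_eq (fun _ => ENNReal.mul_ne_top ENNReal.ofReal_ne_top enorm_ne_top)]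
      exact tsum_congr fun m => by
        rw [ENNReal.toReal_mul, ENNReal.toReal_ofReal (sobolevWeight_pos _ _).le, toReal_enorm]
    have hmaj : Summable fun m => sobolevWeight |r| (l - m) * ‖b (l - m)‖ :=
      (Equiv.subLeft l).summable_iff.2 h1 |>.congr fun m => by simp [Equiv.subLeft]
    calc ∑' m, ‖b (l - m)‖ * sobolevWeight r m
        ≤ ∑' m, (2 : ℝ) ^ (|r| / 2) * sobolevWeight r l * (sobolevWeight |r| (l - m) * ‖b (l - m)‖) := by
          refine (summable_norm_symbol_mul_weight hb r l).tsum_le_tsum (fun m => ?_) (hmaj.mul_left _)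
          have hp : sobolevWeight r m ≤ (2 : ℝ) ^ (|r| / 2) * sobolevWeight |r| (l - m) * sobolevWeight r l := by
            have h := sobolevWeight_le_peetre r m l
            rwa [show sobolevWeight |r| (m - l) = sobolevWeight |r| (l - m) by
              rw [sobolevWeight, sobolevWeight, freqNormSq_sub_comm]] at h
          calc ‖b (l - m)‖ * sobolevWeight r m
              ≤ ‖b (l - m)‖ * ((2 : ℝ) ^ (|r| / 2) * sobolevWeight |r| (l - m) * sobolevWeight r l) := by
                gcongr
            _ = _ := by ring
      _ = (2 : ℝ) ^ (|r| / 2) * sobolevWeight r l * B := by rw [tsum_mul_left, hB]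
  -- fibres and the sum of the fibre sums (stated in reduced form, then assembled)
  have hfib : ∀ l, Summable fun m => ‖a (k - l)‖ * (‖b (l - m)‖ * ‖c m‖) := fun l =>
    (hinner l).mul_left _
  have hsum : Summable fun l => ∑' m, ‖a (k - l)‖ * (‖b (l - m)‖ * ‖c m‖) := by
    refine Summable.of_nonneg_of_le (fun l => tsum_nonneg fun m => by positivity) (fun l => ?_)
      ((summable_norm_symbol_mul_weight ha r k).mul_left (N * (2 : ℝ) ^ (|r| / 2) * B))
    rw [tsum_mul_left]
    calc ‖a (k - l)‖ * ∑' m, ‖b (l - m)‖ * ‖c m‖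
        ≤ ‖a (k - l)‖ * (N * ∑' m, ‖b (l - m)‖ * sobolevWeight r m) := by
          gcongr
          rw [← tsum_mul_left]
          exact (hinner l).tsum_le_tsum (fun m => by
            calc ‖b (l - m)‖ * ‖c m‖ ≤ ‖b (l - m)‖ * (N * sobolevWeight r m) := by gcongr; exact hcN m
              _ = N * (‖b (l - m)‖ * sobolevWeight r m) := by ring)
            ((summable_norm_symbol_mul_weight hb r l).mul_left N)
      _ ≤ ‖a (k - l)‖ * (N * ((2 : ℝ) ^ (|r| / 2) * sobolevWeight r l * B)) := by gcongr; exact hBsum l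
      _ = N * (2 : ℝ) ^ (|r| / 2) * B * (‖a (k - l)‖ * sobolevWeight r l) := by ring
  exact (summable_prod_of_nonneg fun p => by positivity).2 ⟨hfib, hsum⟩

end Majorant

/-! ### Leibniz rule -/

section Leibniz

variable [Fintype d] [CompleteSpace W]

omit [CompleteSpace W] in
/-- Derivatives of a rapidly decreasing symbol are rapidly decreasing (tree:
`Torus.RapidDecay.deriv`). [folklore] -/
theorem _root_.Literature.Analysis.FunctionSpaces.Torus.RapidDecay.freqDeriv
    {a : (d → ℤ) → (V →L[ℂ] W)} (ha : RapidDecay a) (j : d) : RapidDecay (freqDeriv j a) :=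
  ha.deriv j

omit [CompleteSpace W] in
/-- Derivatives of tempered families are tempered (`∂_j : H_s → H_{s-1}`). [folklore] -/
theorem Tempered.freqDeriv {c : (d → ℤ) → V} (hc : Tempered c) (j : d) : Tempered (freqDeriv j c) := by
  obtain ⟨s, hs⟩ := hc
  refine ⟨s - 1, (eNormSq_freqDeriv_le (s - 1) j c).trans_lt (ENNReal.mul_lt_top ENNReal.ofReal_lt_top ?_)⟩
  rwa [sub_add_cancel]

/-- **Leibniz rule** for the frequency-side derivative of a convolution:
`∂_j (a ⋆ c) = (∂_j a) ⋆ c + a ⋆ (∂_j c)` for a rapidly decreasing symbol `a` and a tempered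
family `c` (`2πi k_j = 2πi (k-l)_j + 2πi l_j` under the absolutely convergent sum). Equivalently
`[∂_j, a ⋆] = (∂_j a) ⋆`: the commutator of a first-order operator with a multiplication is of
order zero (Warner (1983), Remark 6.26). [cite: WarnerGTM94, Remark 6.26] -/
theorem freqDeriv_conv {a : (d → ℤ) → (V →L[ℂ] W)} (ha : RapidDecay a) {c : (d → ℤ) → V}
    (hc : Tempered c) (j : d) :
    freqDeriv j (conv a c) = conv (freqDeriv j a) c + conv a (freqDeriv j c) := by
  funext k
  have h1 := summable_conv_term (ha.freqDeriv j) hc k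
  have h2 := summable_conv_term ha (hc.freqDeriv j) k
  simp only [freqDeriv_apply, conv_apply, Pi.add_apply] at h1 h2 ⊢
  rw [← h1.tsum_add h2, ← tsum_const_smul'' (2 * Real.pi * Complex.I * (k j) : ℂ)]
  refine tsum_congr fun l => ?_
  rw [FunLike.coe_smul, Pi.smul_apply, map_smul, ← add_smul, Pi.sub_apply, Int.cast_sub]
  congr 1
  ring

end Leibniz

/-! ### Translations and difference quotients (Warner 6.19, 6.30 (2)) -/

section Transl

/-- The multiplier of the **translation** by `t` along the `j`-th coordinate, `e^{2πi k_j t}`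
(Warner (1983), 6.19 (1), unit torus). [cite: WarnerGTM94, 6.19 (1)] -/
def translMul (j : d) (t : ℝ) (k : d → ℤ) : ℂ := Complex.exp (2 * Real.pi * Complex.I * (k j) * t)

/-- Translation `T_{t e_j}` of a coefficient family: `(T c)(k) = e^{2πi k_j t} c k`
(Warner (1983), 6.19 (1)). [cite: WarnerGTM94, 6.19 (1)] -/
def transl (j : d) (t : ℝ) (c : (d → ℤ) → V) : (d → ℤ) → V := fun k => translMul j t k • c k

/-- Unfolding of `transl`. [folklore] -/
@[simp] theorem transl_apply (j : d) (t : ℝ) (c : (d → ℤ) → V) (k : d → ℤ) :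
    transl j t c k = translMul j t k • c k := rfl

/-- The translation multipliers are unimodular: `|e^{2πi k_j t}| = 1`. [folklore] -/
theorem norm_translMul (j : d) (t : ℝ) (k : d → ℤ) : ‖translMul j t k‖ = 1 := by
  rw [translMul, show (2 * Real.pi * Complex.I * (k j) * t : ℂ) = ((2 * Real.pi * (k j) * t : ℝ) : ℂ) * Complex.I by
    push_cast; ring, Complex.norm_exp_ofReal_mul_I]

/-- `‖(T c)(k)‖ = ‖c k‖`. [folklore] -/
theorem norm_transl_apply (j : d) (t : ℝ) (c : (d → ℤ) → V) (k : d → ℤ) :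
    ‖transl j t c k‖ = ‖c k‖ := by
  rw [transl_apply, norm_smul, norm_translMul, one_mul]

/-- The multipliers are characters: `e^{2πi k_j t} = e^{2πi (k-l)_j t} e^{2πi l_j t}`. [folklore] -/
theorem translMul_eq_mul (j : d) (t : ℝ) (k l : d → ℤ) :
    translMul j t k = translMul j t (k - l) * translMul j t l := by
  rw [translMul, translMul, translMul, ← Complex.exp_add]
  congr 1
  push_cast [Pi.sub_apply]
  ring

/-- The difference quotient is `(T c - c)/t`: `c^t = t⁻¹ • (T c - c)` (Warner 6.19 (2)).
[cite: WarnerGTM94, 6.19 (2)] -/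
theorem diffQuot_eq_smul_transl_sub (j : d) (t : ℝ) (c : (d → ℤ) → V) :
    diffQuot j t c = (t⁻¹ : ℂ) • (transl j t c - c) := by
  funext k
  simp only [diffQuot_apply, diffQuotMul, Pi.smul_apply, Pi.sub_apply, transl_apply, translMul,
    smul_sub, smul_smul, div_eq_inv_mul]
  rw [mul_sub, mul_one, sub_smul]

variable [Fintype d]

/-- **Translations are isometries of every `H_s`** (Warner 6.19 (3): "`‖T_h(u)‖_s = ‖u‖_s`").
[cite: WarnerGTM94, 6.19 (3)] -/
@[simp] theorem eNormSq_transl (s : ℝ) (j : d) (t : ℝ) (c : (d → ℤ) → V) :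
    eNormSq s (transl j t c) = eNormSq s c := by
  refine tsum_congr fun k => ?_
  rw [← ofReal_norm, norm_transl_apply, ofReal_norm]

/-- Translates of tempered families are tempered. [folklore] -/
theorem Tempered.transl {c : (d → ℤ) → V} (hc : Tempered c) (j : d) (t : ℝ) : Tempered (transl j t c) := by
  obtain ⟨s, hs⟩ := hc; exact ⟨s, by rwa [eNormSq_transl]⟩

/-- Translates of rapidly decreasing symbols are rapidly decreasing. [folklore] -/
theorem _root_.Literature.Analysis.FunctionSpaces.Torus.RapidDecay.transl {c : (d → ℤ) → V}
    (hc : RapidDecay c) (j : d) (t : ℝ) : RapidDecay (transl j t c) :=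
  hc.of_norm_le_mul (C := 1) fun k => by rw [norm_transl_apply, one_mul]

/-- Difference quotients of tempered families are tempered. [folklore] -/
theorem Tempered.diffQuot {c : (d → ℤ) → V} (hc : Tempered c) (j : d) (t : ℝ) : Tempered (diffQuot j t c) := by
  rw [diffQuot_eq_smul_transl_sub]; exact ((hc.transl j t).sub hc).const_smul _

/-- Difference quotients of rapidly decreasing symbols are rapidly decreasing. [folklore] -/
theorem _root_.Literature.Analysis.FunctionSpaces.Torus.RapidDecay.diffQuot {c : (d → ℤ) → V}
    (hc : RapidDecay c) (j : d) (t : ℝ) : RapidDecay (diffQuot j t c) :=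
  (hc.deriv j).of_norm_le_mul (C := 1) fun k => by
    rw [diffQuot_apply, norm_smul, norm_smul, one_mul]
    simpa [abs_of_pos Real.pi_pos] using
      mul_le_mul_of_nonneg_right (norm_diffQuotMul_le j t k) (norm_nonneg (c k))

omit [Fintype d] in
/-- **Translations are multiplicative over convolutions**: `T(a ⋆ c) = (T a) ⋆ (T c)`
(unconditionally; the multipliers are characters). [cite: WarnerGTM94, 6.30 (2)] -/
theorem transl_conv (j : d) (t : ℝ) (a : (d → ℤ) → (V →L[ℂ] W)) (c : (d → ℤ) → V) :
    transl j t (conv a c) = conv (transl j t a) (transl j t c) := by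
  funext k
  simp only [transl_apply, conv_apply]
  rw [← tsum_const_smul'' (translMul j t k)]
  refine tsum_congr fun l => ?_
  rw [FunLike.coe_smul, Pi.smul_apply, map_smul, smul_smul, ← translMul_eq_mul]

variable [CompleteSpace W]

/-- **Warner's difference-quotient Leibniz rule** (6.30 (2): "`L(u^h) = (Lu)^h - L^h(T_h u)`"),
for a single multiplication operator: `(a ⋆ c)^t = a^t ⋆ (T c) + a ⋆ c^t`, i.e.
`a ⋆ c^t = (a ⋆ c)^t - a^t ⋆ (T c)`, for rapidly decreasing `a` and tempered `c`.
[cite: WarnerGTM94, 6.30 (2)] -/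
theorem diffQuot_conv {a : (d → ℤ) → (V →L[ℂ] W)} (ha : RapidDecay a) {c : (d → ℤ) → V}
    (hc : Tempered c) (j : d) (t : ℝ) :
    diffQuot j t (conv a c) = conv (diffQuot j t a) (transl j t c) + conv a (diffQuot j t c) := by
  rw [diffQuot_eq_smul_transl_sub, diffQuot_eq_smul_transl_sub, diffQuot_eq_smul_transl_sub,
    transl_conv, conv_const_smul, const_smul_conv, ← smul_add, sub_conv (ha.transl j t) ha (hc.transl j t),
    conv_sub ha (hc.transl j t) hc]
  congr 1
  abel

end Transl

/-! ### Constant coefficients: the Kronecker symbol -/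

section Delta

variable [Fintype d]

/-- The **Kronecker symbol** of a constant coefficient `T`: `δ_T(0) = T`, `δ_T(k) = 0` otherwise —
the coefficient family of the constant function `T`. [folklore] -/
def delta (T : V →L[ℂ] W) : (d → ℤ) → (V →L[ℂ] W) := fun k => if k = 0 then T else 0

/-- Unfolding of `delta`. [folklore] -/
@[simp] theorem delta_apply (T : V →L[ℂ] W) (k : d → ℤ) :
    delta T k = if k = 0 then T else 0 := rfl

/-- **Convolution by a Kronecker symbol is the pointwise constant map**: `δ_T ⋆ c = T ∘ c`
(unconditionally). [folklore] -/
theorem delta_conv (T : V →L[ℂ] W) (c : (d → ℤ) → V) : conv (delta T) c = fun k => T (c k) := by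
  funext k
  rw [conv_apply, tsum_eq_single k]
  · simp
  · intro l hl
    have : k - l ≠ 0 := sub_ne_zero.2 (Ne.symm hl)
    simp [this]

/-- The Kronecker symbol is rapidly decreasing. [folklore] -/
theorem rapidDecay_delta (T : V →L[ℂ] W) : RapidDecay (delta (d := d) T) := by
  intro m
  refine summable_of_ne_finset_zero (s := {0}) fun k hk => ?_
  have hk' : k ≠ 0 := by simpa using hk
  simp [hk']

/-- `A_r(δ_T) = ‖T‖`. [folklore] -/
theorem symbNorm_delta (r : ℝ) (T : V →L[ℂ] W) : symbNorm r (delta (d := d) T) = ‖T‖ₑ := by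
  rw [symbNorm, tsum_eq_single 0]
  · simp
  · intro k hk
    rw [delta_apply, if_neg hk, ← ofReal_norm, norm_zero, ENNReal.ofReal_zero, mul_zero]

end Delta

/-! ### Composition of multipliers -/

section Comp

variable [Fintype d]

/-- The **symbol of a product of multipliers**: `(a ⋆ b)(k) = ∑_l a(k-l) ∘ b(l)` (composition of
the operator values) — on the torus, the coefficient family of the pointwise product `ω₁ ω₂` of
the matrix functions with coefficients `a`, `b`. [folklore] -/
def sconv (a : (d → ℤ) → (W →L[ℂ] X)) (b : (d → ℤ) → (V →L[ℂ] W)) : (d → ℤ) → (V →L[ℂ] X) :=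
  fun k => ∑' l, (a (k - l)).comp (b l)

omit [Fintype d] in
/-- Unfolding of `sconv`. [folklore] -/
theorem sconv_apply (a : (d → ℤ) → (W →L[ℂ] X)) (b : (d → ℤ) → (V →L[ℂ] W)) (k : d → ℤ) :
    sconv a b k = ∑' l, (a (k - l)).comp (b l) := rfl

/-- The terms of `sconv` are absolutely summable for rapidly decreasing `a, b`
(`‖a(k-l) ∘ b(l)‖ ≤ ‖a(k-l)‖ · sup‖b‖`). [folklore] -/
theorem summable_norm_sconv_term {a : (d → ℤ) → (W →L[ℂ] X)} (ha : RapidDecay a)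
    {b : (d → ℤ) → (V →L[ℂ] W)} (hb : RapidDecay b) (k : d → ℤ) :
    Summable fun l => ‖(a (k - l)).comp (b l)‖ := by
  have h1 : Summable fun l => ‖a (k - l)‖ :=
    (Equiv.subLeft k).summable_iff.2 ha.summable_norm |>.congr fun l => by simp [Equiv.subLeft]
  refine Summable.of_nonneg_of_le (fun l => norm_nonneg _) (fun l => ?_) (h1.mul_right (∑' m, ‖b m‖))
  exact (ContinuousLinearMap.opNorm_comp_le _ _).trans
    (mul_le_mul_of_nonneg_left (hb.norm_le_tsum l) (norm_nonneg _))

/-- **The product symbol is rapidly decreasing**: with `(1+|k|²)^m ≤ 2^m (1+|k-l|²)^m (1+|l|²)^m`,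
`∑_k (1+|k|²)^m ‖(a ⋆ b)(k)‖ ≤ 2^m (∑ (1+|k|²)^m ‖a k‖)(∑ (1+|l|²)^m ‖b l‖)`. [folklore] -/
theorem _root_.Literature.Analysis.FunctionSpaces.Torus.RapidDecay.sconv
    {a : (d → ℤ) → (W →L[ℂ] X)} (ha : RapidDecay a) {b : (d → ℤ) → (V →L[ℂ] W)}
    (hb : RapidDecay b) : RapidDecay (sconv a b) := by
  intro m
  -- the dominating double family `(k, l) ↦ 2^m (1+|k-l|²)^m ‖a(k-l)‖ (1+|l|²)^m ‖b l‖`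
  have hprod : Summable fun p : (d → ℤ) × (d → ℤ) =>
      ((1 + freqNormSq (p.1 - p.2)) ^ m * ‖a (p.1 - p.2)‖) * ((1 + freqNormSq p.2) ^ m * ‖b p.2‖) := by
    have h := (ha m).mul_of_nonneg (hb m) (fun k => mul_nonneg (one_add_freqNormSq_pow_nonneg k m) (norm_nonneg _))
      (fun k => mul_nonneg (one_add_freqNormSq_pow_nonneg k m) (norm_nonneg _))
    -- shear `(k, l) ↦ (k - l, l)`
    let e : (d → ℤ) × (d → ℤ) ≃ (d → ℤ) × (d → ℤ) :=
      { toFun := fun p => (p.1 - p.2, p.2), invFun := fun p => (p.1 + p.2, p.2),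
        left_inv := fun p => by simp, right_inv := fun p => by simp }
    exact (e.summable_iff.2 h)
  have hfib : ∀ k, Summable fun l =>
      ((1 + freqNormSq (k - l)) ^ m * ‖a (k - l)‖) * ((1 + freqNormSq l) ^ m * ‖b l‖) := fun k =>
    hprod.prod_factor k
  refine Summable.of_nonneg_of_le (fun k => mul_nonneg (one_add_freqNormSq_pow_nonneg k m) (norm_nonneg _))
    (fun k => ?_) ((hprod.prod.mul_left ((2 : ℝ) ^ m)))
  -- termwise: `(1+|k|²)^m ‖∑_l a(k-l) b(l)‖ ≤ 2^m ∑_l (1+|k-l|²)^m‖a(k-l)‖ (1+|l|²)^m ‖b l‖`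
  have hsum := summable_norm_sconv_term ha hb k
  calc (1 + freqNormSq k) ^ m * ‖Lattice.sconv a b k‖
      ≤ (1 + freqNormSq k) ^ m * ∑' l, ‖(a (k - l)).comp (b l)‖ :=
        mul_le_mul_of_nonneg_left (norm_tsum_le_tsum_norm hsum) (one_add_freqNormSq_pow_nonneg k m)
    _ = ∑' l, (1 + freqNormSq k) ^ m * ‖(a (k - l)).comp (b l)‖ := by rw [tsum_mul_left]
    _ ≤ ∑' l, (2 : ℝ) ^ m * (((1 + freqNormSq (k - l)) ^ m * ‖a (k - l)‖) *
          ((1 + freqNormSq l) ^ m * ‖b l‖)) := by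
        refine (hsum.mul_left _).tsum_le_tsum (fun l => ?_) ((hfib k).mul_left _)
        have h0 : 0 ≤ 1 + freqNormSq k := by linarith [freqNormSq_nonneg k]
        calc (1 + freqNormSq k) ^ m * ‖(a (k - l)).comp (b l)‖
            ≤ (2 * (1 + freqNormSq (k - l)) * (1 + freqNormSq l)) ^ m * (‖a (k - l)‖ * ‖b l‖) :=
              mul_le_mul (pow_le_pow_left₀ h0 (one_add_freqNormSq_le k l) m)
                (ContinuousLinearMap.opNorm_comp_le _ _) (norm_nonneg _)
                (pow_nonneg (mul_nonneg (mul_nonneg zero_le_two (by linarith [freqNormSq_nonneg (k - l)]))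
                  (by linarith [freqNormSq_nonneg l])) m)
          _ = _ := by rw [mul_pow, mul_pow]; ring
    _ = (2 : ℝ) ^ m * ∑' l, ((1 + freqNormSq (k - l)) ^ m * ‖a (k - l)‖) *
          ((1 + freqNormSq l) ^ m * ‖b l‖) := tsum_mul_left

variable [CompleteSpace W] [CompleteSpace X]

/-- **Associativity: composition of multipliers** `a ⋆ (b ⋆ c) = (a ⋆ b) ⋆ c` for rapidly
decreasing symbols `a, b` and a tempered family `c` (Fubini for the absolutely convergent double
series `∑_l ∑_m a(k-l) b(l-m) c(m)`, re-indexed by `l = m + l'`). On the torus: multiplying by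
`ω₂` and then by `ω₁` is multiplying by `ω₁ω₂`. [folklore] -/
theorem conv_conv {a : (d → ℤ) → (W →L[ℂ] X)} (ha : RapidDecay a) {b : (d → ℤ) → (V →L[ℂ] W)}
    (hb : RapidDecay b) {c : (d → ℤ) → V} (hc : Tempered c) :
    conv a (conv b c) = conv (sconv a b) c := by
  funext k
  -- the double family and its absolute summability
  obtain ⟨F, hF⟩ : ∃ F : (d → ℤ) × (d → ℤ) → X, ∀ p, F p = a (k - p.1) (b (p.1 - p.2) (c p.2)) :=
    ⟨_, fun _ => rfl⟩
  have hFn : Summable fun p : (d → ℤ) × (d → ℤ) => ‖F p‖ :=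
    Summable.of_nonneg_of_le (fun p => norm_nonneg _) (fun p => by
      rw [hF]
      calc ‖a (k - p.1) (b (p.1 - p.2) (c p.2))‖ ≤ ‖a (k - p.1)‖ * ‖b (p.1 - p.2) (c p.2)‖ :=
            (a (k - p.1)).le_opNorm _
        _ ≤ ‖a (k - p.1)‖ * (‖b (p.1 - p.2)‖ * ‖c p.2‖) := by
            gcongr; exact (b (p.1 - p.2)).le_opNorm _)
      (summable_norm_conv_conv_term ha hb hc k)
  have hFs : Summable F := hFn.of_norm
  -- left side: `∑_l a(k-l) (∑_m b(l-m) c m) = ∑_l ∑_m F (l, m)`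
  have hL : conv a (conv b c) k = ∑' l, ∑' m, F (l, m) := by
    rw [conv_apply]
    refine tsum_congr fun l => ?_
    rw [conv_apply, (a (k - l)).map_tsum (summable_conv_term hb hc l)]
    exact tsum_congr fun m => (hF (l, m)).symm
  -- right side: `∑_m (∑_{l'} a(k-m-l') b(l')) (c m) = ∑_m ∑_l F (l, m)`
  have hR : conv (sconv a b) c k = ∑' m, ∑' l, F (l, m) := by
    rw [conv_apply]
    refine tsum_congr fun m => ?_
    have happ : (∑' l, (a (k - m - l)).comp (b l)) (c m) = ∑' l, ((a (k - m - l)).comp (b l)) (c m) := by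
      simpa only [ContinuousLinearMap.apply_apply] using
        (ContinuousLinearMap.apply ℂ X (c m)).map_tsum ((summable_norm_sconv_term ha hb (k - m)).of_norm)
    rw [sconv_apply, happ, ← (Equiv.addRight m).tsum_eq (fun l' => F (l', m))]
    refine tsum_congr fun l => ?_
    simp only [Equiv.coe_addRight, hF, ContinuousLinearMap.comp_apply, add_sub_cancel_right]
    rw [show k - (l + m) = k - m - l by abel]
  rw [hL, hR]
  have hunc : Summable (Function.uncurry fun l m => F (l, m)) := hFs
  exact (hunc.tsum_comm' (fun l => hFs.prod_factor l) fun m => hFs.prod_symm.prod_factor m).symm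

end Comp

end Lattice

end Literature.Analysis.FunctionSpaces
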